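import Summits.QuantumFields.BalabanUV.Beta.NVertexSectors
import Summits.QuantumFields.BalabanUV.Beta.CombHId1Record
import Summits.QuantumFields.BalabanUV.Beta.FP.TorusCompositeObjects

/-!
# `BalabanUV.Beta.NVertexSectorsPeriodised` — row D1 ∕ (C1), PART 11: **THE PERIODISED N-VERTEX — EACH SECTOR OF `VN R P j μ y` ON A TORUS `M` WITH
# `Lc^(j+1) ∣ M` IS THE TORUS-`ℋ`-COLUMN-WEIGHTED BOX SUM OF ITS PERIODISED TABLES; THE `ff` BLOCK THAT `hHN₁` READS, IN THE SHAPE OF `hH₁f`'s W TERM**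

WHY (located).  PART 10 (`NVertexSectors`) split the N-system's vertex into three chain-rule vertices through the N-chart column,
`VN R P j = cE (j+1) • 𝒲N + cVH (j+1) • 𝒱bN + cΛ (j+1) • ℒN`, and showed its field–field block has the Wilson and the Λ sector only.  The END wrapper's binder
`hHN₁ : H'₁f (dv (μ,y)) = (perF T (dper T (VN … (n+1) μ y)))|ff` reads that block PERIODISED on the finest torus `T`, while its pin `hH₁f` displays the W term as
`(−2c) • Σ_{b ∈ pbox T × Fin 4} hb b • (perF T (dper T (wilsonA b)))|ff`.  THIS FILE puts the row's side in exactly that currency, by an2 g42's (J-a) dictionary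
at the N-chart: for every box `M` with `Lc^(j+1) ∣ M i`, the N-chart `AN R j` is `M`-translation invariant (`shiftK_compChart` ∘ `translate_invariant_of_shiftK`)
and decays (`decays_compChart`), every sector's table family is period-covariant and bond-localised (lit `wilsonA_translate` ∕ `locStencil_wilsonA`; F3's
(TV)(LV); `SLam_translate` + `lamCoeffOf_translate` + (TH)(LH)), so `CombHId1Letters.dper_vertexOfK` + `CombHId1Sandwich.perF_vertexOfK_dper_apply` +
`perZ_coarse_col_eq_perF` give, for each sector and for the whole family (§2 **`perF_dper_vertexOfK_AN`**, **`perF_dper_vertexOfK_AN_eq_sum`**),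
  `perF M (dper M (vertexOfK (AN R j) (Lc^(j+1)) S μ y)) = Σ_{b ∈ pbox M × Fin 4} (perF M (AN R j)) ((b.1, inl b.2), (wrapPt M (Lc^(j+1)•y), inr μ)) • perF M (dper M (S b.2 b.1))`
— THE WEIGHT IS THE TORUS `ℋ`-COLUMN ENTRY OF THE N-CHART AT THE COARSE BOND.  §3 periodises PART 10's split termwise (`CombHId1Record.dper_add_smul₃`,
`perF_add`, `perF_smul` under the three sectors' vertex-family letters): **`perF_dper_VN_eq`**, the border sector's `ff` entries vanish (`perF_dper_VbN_inl_inl`),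
**`perF_dper_VN_submatrix_ff`** (the `|ff` block = `cE • (perF M (dper M 𝒲N))|ff + cΛ • (perF M (dper M ℒN))|ff`) and **`perF_dper_VN_submatrix_ff_eq_sum`** —
the `ff` block of `hHN₁`'s right side written as `cE (j+1) • Σ_b colN b • (perF M (dper M (wilsonA 3 b.2 b.1)))|ff + cΛ (j+1) • Σ_b colN b • (perF M (dper M (S^Λ b.2 b.1)))|ff`
with `colN b := (perF M (AN R j)) ((b.1, inl b.2), (wrapPt M (Lc^(j+1)•y), inr μ))`.  READING (J-RISK-1 as ONE located scalar junction, the wrapper's displayed data —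
instantiation is the road's): the W term of `hH₁f` matches the W sector of `hHN₁` iff `(−2c n) · hb n B (n+1) (dv n B (μ,y)) b = cE (n+2) · colN b` at
`M := towerTorus Lc (fine Lc (Mc B)) (n+1)`, `j := n+1`, `R := Roots.ctr Lc`.

WHAT ([folklore] bookkeeping BY NAME; no `def`, no `def … : Prop`, nothing cited, 0 sorry): §1 letters of the N-chart and of the three table families on a box
`M` with `Lc^(j+1) ∣ M i` (`AN_translate_invariant`, `periodCov_of_St`, `wilsonA_St`, `lamSector_St`, `locStencil_lamSector`, `JNat_S_St`, `locStencil_JNat_S`);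
§2 `perF_dper_vertexOfK_AN`, `perF_dper_vertexOfK_AN_eq_sum` (generic period-covariant localised family) and the four instances
`perF_dper_WN_eq_sum`, `perF_dper_VbN_eq_sum`, `perF_dper_LN_eq_sum`, `perF_dper_VN_eq_sum_tables`; §3 `VN_apply_eq_sectors`, `perF_dper_VN_eq`,
`perF_dper_VbN_inl_inl`, `perF_dper_VN_inl_inl`, `perF_dper_VN_submatrix_ff`, `perF_dper_VN_submatrix_ff_eq_sum`; §4 AT THE WRAPPER's FINEST TORUS
`towerTorus Lc (fine Lc M) (n+1)` (leaf-05 ∕ road FP `TorusCompositeObjects`): `dvd_towerTorus_fine` (`Lc^(n+2) ∣` its moduli, `towerTorus_apply`) and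
**`perF_dper_VN_submatrix_ff_tower`** — the `ff` block of `hHN₁`'s right side at `j := n+1` with NO side condition left.
WHAT THIS IS NOT: not the junction letter `hb ↔ colN` ∕ `−2c ↔ cE` itself (displayed data of the wrapper); not the Λ-sector's storey unrolling against
`w • Σ hb Λ|ff + compSumSym …` (F6a′∕F6a″∕F6a‴∕PART 8 + the road's SPEC-48 (B)); not the `X`-conjugation of `hH'₁f` (W-1 of gen 61: the `ff` block here has
no commutator sector); no row of the END wrapper discharged; 0 estimates; nothing of Bałaban's asserted, valued or discharged; 0∕4 row-D1 binders (hW, hR, D1Tel,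
D1Rep); ROOT M‴ p325680 ∕ P5c ∕ D6 untouched; NOT (C1), NOT (L2′), NOT D1, NEVER «G-an2-4 closed», NOT BetaPertH, NOT continuum, NOT Clay.

HONEST DEPENDENCY (page 1, mandatory): continuum YM on T⁴ ⇐ BetaPertH ∧ nine spine estimates (0/9 proved); BetaPertH ⇐ (D1) ∧ (D4) ∧ CAP+tail;
G-an2-4 gates asym, D1 and NE2/3/4.  HONEST FRAMING (cell contract, verbatim): «discharging `BetaPertH` makes Bałaban's UV stability UNCONDITIONAL —
a real constructive-QFT result; it is NOT the continuum limit and NOT the Clay problem.»  ABSOLUTE RULE (cell charter, verbatim): «No internally-minted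
statement may enter as a cited fact. Every hypothesis is either kernel-proved in this package or a verbatim quotation of a PUBLISHED theorem with page
reference. The manuscript(s) under audit are NOT citable for their own disputed steps — they are the thing under adjudication; programme-internal
(2001/route/tribunal) claims are never citable.»  Row D1 ∕ (C1) OWNER an2 (b2b-balaban-beta-an2) gen 61, 2026-08-26.  No existing file touched.
-/

noncomputable section

open scoped BigOperators

namespace Summit.QuantumFields.BalabanUV.Beta.NVertexSectorsPeriodised

open Finset Matrix
open Literature.MathematicalPhysics.QuantumFieldTheory
open Literature.MathematicalPhysics.QuantumFieldTheory.Balaban1983to89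
open Literature.MathematicalPhysics.QuantumFieldTheory.Balaban1983to89.Beta
open B4TorusKernel.MultiPeriod (translate)
open B5Prop11Plancherel (fine)
open B6Lemma24Torus (pbox)
open ExpKernelCalculus (MKer Decays BiLoc VertexFamily shiftK)
open AffineAveraging (Site box toSite)
open OneStepResolventKernel (Fib KInv LocStencil decays_KInv shiftK_KInv biLoc_mono)
open OneStepKernelFamily (colH vertexOfK)
open InterLevelTransport (SLam locStencil_SLam SLam_translate)
open StepJetData (wilsonA wBound locStencil_wilsonA wilsonA_translate)
open BalabanStepJets (lamCoeffOf abs_lamCoeffOf_le lamCoeffOf_translate)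
open Summit.QuantumFields.BalabanUV.Beta.AxialDressingRooted (one_le_of_neZero)
open Summit.QuantumFields.BalabanUV.Beta.ChartStepJets (SchartOf_translate locStencil_SchartOf)
open Summit.QuantumFields.BalabanUV.Beta.CompositeCorrectorDress (compChart)
open Summit.QuantumFields.BalabanUV.Beta.CompositeOneShotJets (compV compH compV_hV compH_hH compV_hVt compH_hHt tabsComp decays_compChart shiftK_compChart)
open Summit.QuantumFields.BalabanUV.Beta.CompositeOneShotJetData (Roots Pins JNat JNat_S AN AN_eq VN VN_eq)
open Summit.QuantumFields.BalabanUV.Beta.FP.KernelPeriodisationFib (Idx perF perF_apply perZ perZ_apply perF_add perF_smul translate_invariant_of_shiftK)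
open Summit.QuantumFields.BalabanUV.Beta.FP.KernelPeriodisationFibLoc (dper dper_apply decays_dper)
open Summit.QuantumFields.BalabanUV.Beta.FP.TorusGaugeCovariancePairing (wrapPt)
open Summit.QuantumFields.BalabanUV.Beta.FP.TorusCompositeObjects (towerTorus towerTorus_apply towerTorus_succ)
open Summit.QuantumFields.BalabanUV.Beta.CombHId1Letters (dper_vertexOfK perZ_coarse_col_eq_perF periodCov_of_shiftK_cov)
open Summit.QuantumFields.BalabanUV.Beta.CombHId1Sandwich (perF_vertexOfK_dper_apply)
open Summit.QuantumFields.BalabanUV.Beta.CombHId1Torus (submatrix_sum_smul)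
open Summit.QuantumFields.BalabanUV.Beta.CombHId1Record (dper_add_smul₃ decays_add' decays_smul')
open Summit.QuantumFields.BalabanUV.Beta.NVertexSectors (decays_AN VN_eq_sectors vertexOfK_compV_inl_inl vertexFamily_WN vertexFamily_VbN vertexFamily_LN)

variable {Lc : ℕ} [NeZero Lc] (R : Roots Lc) (P : Pins) (j : ℕ) (M : Fin (3 + 1) → ℕ) [∀ μ, NeZero (M μ)]

/-! ## §1 Letters on a box `M` with `Lc^(j+1) ∣ M i` -/

section Letters

omit [∀ μ, NeZero (M μ)] in
/-- [folklore] **the N-chart is invariant under the period lattice of every box with `Lc^(j+1) ∣ M i`** (`shiftK_compChart` ∘ `translate_invariant_of_shiftK`). -/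
theorem AN_translate_invariant (hM : ∀ i, Lc ^ (j + 1) ∣ M i) (m x z : Site (3 + 1)) (a b : Fib 3) :
    AN R j (translate M x m) (translate M z m) a b = AN R j x z a b := by
  refine translate_invariant_of_shiftK M (N := Lc ^ (j + 1)) (K := AN R j) (fun t => ?_) hM m x z a b
  have h := shiftK_compChart (rc := R.rc) (s := R.s (j + 1)) (one_le_of_neZero Lc) (j + 1) (-t)
  rw [smul_neg, neg_neg] at h
  rw [AN_eq]
  exact h

omit [∀ μ, NeZero (M μ)] in
/-- [folklore] a family with the `(St)` covariance shape at blocking `N` is period-covariant on every box with `N ∣ M i` (an2 g42's bridge, restated at `d = 3` for the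
three sector families below). -/
theorem periodCov_of_St {N : ℕ} {S : Fin (3 + 1) → Site (3 + 1) → MKer (3 + 1) (Fib 3)}
    (hS : ∀ (κ : Fin (3 + 1)) (u t : Site (3 + 1)), S κ (u + (N : ℤ) • t) = shiftK (-((N : ℤ) • t)) (S κ u)) (hM : ∀ i, N ∣ M i)
    (κ : Fin (3 + 1)) (u m x z : Site (3 + 1)) (a b : Fib 3) :
    S κ (translate M u m) (translate M x m) (translate M z m) a b = S κ u x z a b :=
  periodCov_of_shiftK_cov M hS hM κ u m x z a b

omit [NeZero Lc] [∀ μ, NeZero (M μ)] in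
/-- [folklore] the Wilson table has the `(St)` shape at every blocking (lit `wilsonA_translate`). -/
theorem wilsonA_St (N : ℕ) (κ : Fin (3 + 1)) (u t : Site (3 + 1)) :
    wilsonA 3 κ (u + (N : ℤ) • t) = shiftK (-((N : ℤ) • t)) (wilsonA 3 κ u) :=
  wilsonA_translate κ u _

/-- [folklore] **the Λ-sector table `S^Λ := SLam (Lc^(j+1)) (lamCoeffOf (KInv (Lc^(j+1))) (Lc^(j+1))) (compH R.r Lc (j+1))` has the `(St)` shape at blocking `Lc^(j+1)`**
(`SLam_translate` with `lamCoeffOf_translate` ∘ `shiftK_KInv` and (TH) `compH_hHt`). -/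
theorem lamSector_St (κ : Fin (3 + 1)) (u t : Site (3 + 1)) :
    SLam (Lc ^ (j + 1)) (lamCoeffOf (KInv (N := Lc ^ (j + 1)) (d := 3)) (Lc ^ (j + 1))) (compH R.r Lc (j + 1)) κ
        (u + ((Lc ^ (j + 1) : ℕ) : ℤ) • t) =
      shiftK (-(((Lc ^ (j + 1) : ℕ) : ℤ) • t))
        (SLam (Lc ^ (j + 1)) (lamCoeffOf (KInv (N := Lc ^ (j + 1)) (d := 3)) (Lc ^ (j + 1))) (compH R.r Lc (j + 1)) κ u) :=
  SLam_translate (N := Lc ^ (j + 1)) (fun μ y κ' u' t' => lamCoeffOf_translate (fun t'' => shiftK_KInv (N := Lc ^ (j + 1)) t'') μ y κ' u' t')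
    (compH_hHt (r := R.r) (L := Lc) (j + 1)) κ u t

/-- [folklore] **the Λ-sector table is a local stencil family** (`locStencil_SLam` with `abs_lamCoeffOf_le` at the decay of `KInv (Lc^(j+1))` and (LH)). -/
theorem locStencil_lamSector : ∃ Cs δs : ℝ, 0 < δs ∧
    LocStencil (SLam (Lc ^ (j + 1)) (lamCoeffOf (KInv (N := Lc ^ (j + 1)) (d := 3)) (Lc ^ (j + 1))) (compH R.r Lc (j + 1))) Cs δs := by
  obtain ⟨δ₀, C, hδ₀, hC, hdec⟩ := decays_KInv (N := Lc ^ (j + 1)) (d := 3)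
  have hc := abs_lamCoeffOf_le (N := Lc ^ (j + 1)) hdec hC hδ₀.le
  obtain ⟨Cq, hQ⟩ := compH_hH (j + 1) (one_le_of_neZero Lc) R.hr δ₀ hδ₀.le
  exact ⟨_, _, half_pos hδ₀, locStencil_SLam (N := Lc ^ (j + 1)) hc hQ hδ₀ (mul_nonneg (mul_nonneg (by positivity) hC) (Real.exp_pos _).le)⟩

/-- [folklore] **the whole first-order family of the raw composite jets has the `(St)` shape at blocking `Lc^(j+1)`** (F6d-1a `SchartOf_translate` with the N-chart's
block covariance `shiftK_compChart`). -/
theorem JNat_S_St (κ : Fin (3 + 1)) (u t : Site (3 + 1)) :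
    (JNat R P (j + 1)).S κ (u + ((Lc ^ (j + 1) : ℕ) : ℤ) • t) = shiftK (-(((Lc ^ (j + 1) : ℕ) : ℤ) • t)) ((JNat R P (j + 1)).S κ u) := by
  rw [JNat_S]
  exact SchartOf_translate (G := fun _ => compChart R.rc Lc (j + 1) (R.s (j + 1)) (Lc ^ (j + 1)))
    (tabs := tabsComp (j + 1) (one_le_of_neZero Lc) R.hr (P.cM (j + 1))) (P.cE (j + 1)) (P.cVH (j + 1)) (P.cΛ (j + 1))
    (fun _ t' => shiftK_compChart (rc := R.rc) (s := R.s (j + 1)) (one_le_of_neZero Lc) (j + 1) t') 0 κ u t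

/-- [folklore] the whole family is a local stencil family (F6d-1a `locStencil_SchartOf … 0` with `decays_compChart`). -/
theorem locStencil_JNat_S : ∃ Cs δs : ℝ, 0 < δs ∧ LocStencil (JNat R P (j + 1)).S Cs δs := by
  rw [JNat_S]
  exact locStencil_SchartOf (G := fun _ => compChart R.rc Lc (j + 1) (R.s (j + 1)) (Lc ^ (j + 1)))
    (tabs := tabsComp (j + 1) (one_le_of_neZero Lc) R.hr (P.cM (j + 1))) (P.cE (j + 1)) (P.cVH (j + 1)) (P.cΛ (j + 1))
    (fun _ => decays_compChart (one_le_of_neZero Lc) R.hrc (j + 1) (R.hs (j + 1))) 0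

end Letters

/-! ## §2 The periodised chain-rule vertex through the N-chart: torus-column-weighted box sums -/

section BoxSums

/-- [folklore] **`perF_dper_vertexOfK_AN` — THE PERIODISED CHAIN-RULE VERTEX THROUGH THE N-CHART, ENTRYWISE**: for a box `M` with `Lc^(j+1) ∣ M i` and a family `S`
with the `(St)` shape at blocking `Lc^(j+1)`, bond-localised,
`perF M (dper M (vertexOfK (AN R j) (Lc^(j+1)) S μ y)) P Q = Σ_{b ∈ pbox M × Fin 4} (perF M (AN R j)) ((b.1, inl b.2), (wrapPt M (Lc^(j+1)•y), inr μ)) · perF M (dper M (S b.2 b.1)) P Q`. -/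
theorem perF_dper_vertexOfK_AN (hM : ∀ i, Lc ^ (j + 1) ∣ M i) {S : Fin (3 + 1) → Site (3 + 1) → MKer (3 + 1) (Fib 3)} {Cs δs : ℝ}
    (hSt : ∀ (κ : Fin (3 + 1)) (u t : Site (3 + 1)), S κ (u + ((Lc ^ (j + 1) : ℕ) : ℤ) • t) = shiftK (-(((Lc ^ (j + 1) : ℕ) : ℤ) • t)) (S κ u))
    (hS : LocStencil S Cs δs) (hδs : 0 < δs) (μ : Fin (3 + 1)) (y : Site (3 + 1)) (p q : Idx M (Fib 3)) :
    perF M (dper M (vertexOfK (AN R j) (Lc ^ (j + 1)) S μ y)) p q =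
      ∑ b : ↥(pbox M) × Fin (3 + 1), perF M (AN R j) (b.1, Sum.inl b.2) (wrapPt M (((Lc ^ (j + 1) : ℕ) : ℤ) • y), Sum.inr μ) *
        perF M (dper M (S b.2 (b.1 : Site (3 + 1)))) p q := by
  obtain ⟨δK, CK, hδK, hCK, hK⟩ := decays_AN R j
  have hKinv := AN_translate_invariant R j M hM
  have hSt' := periodCov_of_St M hSt hM
  have hCs : 0 ≤ Cs := (hS 0 0).nonneg (Sum.inl 0)
  rw [dper_vertexOfK M hKinv hK hCK hδK hSt' hS hCs hδs μ y, perF_vertexOfK_dper_apply M hKinv hK hδK hSt' hS hδs μ y p q,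
    Fintype.sum_prod_type]
  refine Finset.sum_congr rfl fun u _ => Finset.sum_congr rfl fun κ _ => ?_
  rw [perZ_coarse_col_eq_perF M]

/-- [folklore] **`perF_dper_vertexOfK_AN_eq_sum` — THE SAME AS A MATRIX IDENTITY**:
`perF M (dper M (vertexOfK (AN R j) (Lc^(j+1)) S μ y)) = Σ_b (perF M (AN R j)) ((b.1, inl b.2), (wrapPt M (Lc^(j+1)•y), inr μ)) • perF M (dper M (S b.2 b.1))`. -/
theorem perF_dper_vertexOfK_AN_eq_sum (hM : ∀ i, Lc ^ (j + 1) ∣ M i) {S : Fin (3 + 1) → Site (3 + 1) → MKer (3 + 1) (Fib 3)} {Cs δs : ℝ}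
    (hSt : ∀ (κ : Fin (3 + 1)) (u t : Site (3 + 1)), S κ (u + ((Lc ^ (j + 1) : ℕ) : ℤ) • t) = shiftK (-(((Lc ^ (j + 1) : ℕ) : ℤ) • t)) (S κ u))
    (hS : LocStencil S Cs δs) (hδs : 0 < δs) (μ : Fin (3 + 1)) (y : Site (3 + 1)) :
    perF M (dper M (vertexOfK (AN R j) (Lc ^ (j + 1)) S μ y)) =
      ∑ b : ↥(pbox M) × Fin (3 + 1), perF M (AN R j) (b.1, Sum.inl b.2) (wrapPt M (((Lc ^ (j + 1) : ℕ) : ℤ) • y), Sum.inr μ) •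
        perF M (dper M (S b.2 (b.1 : Site (3 + 1)))) := by
  ext p q
  rw [perF_dper_vertexOfK_AN R j M hM hSt hS hδs μ y p q, Matrix.sum_apply]
  simp only [Matrix.smul_apply, smul_eq_mul]

/-- [folklore] **THE WILSON SECTOR PERIODISED** — in the shape of `hH₁f`'s W term: `perF M (dper M (𝒲N μ y)) = Σ_b colN b • perF M (dper M (wilsonA 3 b.2 b.1))`. -/
theorem perF_dper_WN_eq_sum (hM : ∀ i, Lc ^ (j + 1) ∣ M i) (μ : Fin (3 + 1)) (y : Site (3 + 1)) :
    perF M (dper M (vertexOfK (AN R j) (Lc ^ (j + 1)) (wilsonA 3) μ y)) =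
      ∑ b : ↥(pbox M) × Fin (3 + 1), perF M (AN R j) (b.1, Sum.inl b.2) (wrapPt M (((Lc ^ (j + 1) : ℕ) : ℤ) • y), Sum.inr μ) •
        perF M (dper M (wilsonA 3 b.2 (b.1 : Site (3 + 1)))) :=
  perF_dper_vertexOfK_AN_eq_sum R j M hM (wilsonA_St (Lc ^ (j + 1))) (locStencil_wilsonA (d := 3) (δ := 1) zero_le_one) zero_lt_one μ y

/-- [folklore] the border sector periodised (read by `hQN₁`): `perF M (dper M (𝒱bN μ y)) = Σ_b colN b • perF M (dper M (compV R.r Lc (j+1) b.2 b.1))`. -/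
theorem perF_dper_VbN_eq_sum (hM : ∀ i, Lc ^ (j + 1) ∣ M i) (μ : Fin (3 + 1)) (y : Site (3 + 1)) :
    perF M (dper M (vertexOfK (AN R j) (Lc ^ (j + 1)) (compV R.r Lc (j + 1)) μ y)) =
      ∑ b : ↥(pbox M) × Fin (3 + 1), perF M (AN R j) (b.1, Sum.inl b.2) (wrapPt M (((Lc ^ (j + 1) : ℕ) : ℤ) • y), Sum.inr μ) •
        perF M (dper M (compV R.r Lc (j + 1) b.2 (b.1 : Site (3 + 1)))) := by
  obtain ⟨C, hC⟩ := compV_hV (j + 1) (one_le_of_neZero Lc) R.hr 1 zero_le_one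
  exact perF_dper_vertexOfK_AN_eq_sum R j M hM (compV_hVt (r := R.r) (j + 1) (one_le_of_neZero Lc)) hC zero_lt_one μ y

/-- [folklore] **THE Λ SECTOR PERIODISED**: `perF M (dper M (ℒN μ y)) = Σ_b colN b • perF M (dper M (S^Λ b.2 b.1))`. -/
theorem perF_dper_LN_eq_sum (hM : ∀ i, Lc ^ (j + 1) ∣ M i) (μ : Fin (3 + 1)) (y : Site (3 + 1)) :
    perF M (dper M (vertexOfK (AN R j) (Lc ^ (j + 1))
        (SLam (Lc ^ (j + 1)) (lamCoeffOf (KInv (N := Lc ^ (j + 1)) (d := 3)) (Lc ^ (j + 1))) (compH R.r Lc (j + 1))) μ y)) =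
      ∑ b : ↥(pbox M) × Fin (3 + 1), perF M (AN R j) (b.1, Sum.inl b.2) (wrapPt M (((Lc ^ (j + 1) : ℕ) : ℤ) • y), Sum.inr μ) •
        perF M (dper M (SLam (Lc ^ (j + 1)) (lamCoeffOf (KInv (N := Lc ^ (j + 1)) (d := 3)) (Lc ^ (j + 1))) (compH R.r Lc (j + 1)) b.2
          (b.1 : Site (3 + 1)))) := by
  obtain ⟨Cs, δs, hδs, hS⟩ := locStencil_lamSector R j
  exact perF_dper_vertexOfK_AN_eq_sum R j M hM (lamSector_St R j) hS hδs μ y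

/-- [folklore] **THE WHOLE N-VERTEX PERIODISED OVER ITS TABLES**: `perF M (dper M (VN R P j μ y)) = Σ_b colN b • perF M (dper M ((JNat R P (j+1)).S b.2 b.1))`. -/
theorem perF_dper_VN_eq_sum_tables (hM : ∀ i, Lc ^ (j + 1) ∣ M i) (μ : Fin (3 + 1)) (y : Site (3 + 1)) :
    perF M (dper M (VN R P j μ y)) =
      ∑ b : ↥(pbox M) × Fin (3 + 1), perF M (AN R j) (b.1, Sum.inl b.2) (wrapPt M (((Lc ^ (j + 1) : ℕ) : ℤ) • y), Sum.inr μ) •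
        perF M (dper M ((JNat R P (j + 1)).S b.2 (b.1 : Site (3 + 1)))) := by
  obtain ⟨Cs, δs, hδs, hS⟩ := locStencil_JNat_S R P j
  rw [VN_eq]
  exact perF_dper_vertexOfK_AN_eq_sum R j M hM (JNat_S_St R P j) hS hδs μ y

end BoxSums

/-! ## §3 The periodised N-vertex by sectors; its `ff` block -/

section Sectors

/-- [folklore] PART 10's three-sector split read at the coarse bond `(μ, y)`. -/
theorem VN_apply_eq_sectors (μ : Fin (3 + 1)) (y : Site (3 + 1)) :
    VN R P j μ y =
      P.cE (j + 1) • vertexOfK (AN R j) (Lc ^ (j + 1)) (wilsonA 3) μ y +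
        P.cVH (j + 1) • vertexOfK (AN R j) (Lc ^ (j + 1)) (compV R.r Lc (j + 1)) μ y +
        P.cΛ (j + 1) • vertexOfK (AN R j) (Lc ^ (j + 1))
          (SLam (Lc ^ (j + 1)) (lamCoeffOf (KInv (N := Lc ^ (j + 1)) (d := 3)) (Lc ^ (j + 1))) (compH R.r Lc (j + 1))) μ y := by
  rw [VN_eq_sectors]
  rfl

/-- [folklore] **`perF_dper_VN_eq` — THE PERIODISED N-VERTEX IS THE WEIGHTED SUM OF ITS THREE PERIODISED SECTORS** (termwise periodisation under the three
vertex-family letters of PART 10 §3: `dper_add_smul₃`, `perF_add`, `perF_smul`). -/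
theorem perF_dper_VN_eq (μ : Fin (3 + 1)) (y : Site (3 + 1)) :
    perF M (dper M (VN R P j μ y)) =
      P.cE (j + 1) • perF M (dper M (vertexOfK (AN R j) (Lc ^ (j + 1)) (wilsonA 3) μ y)) +
        P.cVH (j + 1) • perF M (dper M (vertexOfK (AN R j) (Lc ^ (j + 1)) (compV R.r Lc (j + 1)) μ y)) +
        P.cΛ (j + 1) • perF M (dper M (vertexOfK (AN R j) (Lc ^ (j + 1))
          (SLam (Lc ^ (j + 1)) (lamCoeffOf (KInv (N := Lc ^ (j + 1)) (d := 3)) (Lc ^ (j + 1))) (compH R.r Lc (j + 1))) μ y)) := by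
  obtain ⟨CW, δW, hδW, hWf⟩ := vertexFamily_WN R j
  obtain ⟨CV, δV, hδV, hVf⟩ := vertexFamily_VbN R j
  obtain ⟨CL, δL, hδL, hLf⟩ := vertexFamily_LN R j
  -- one common rate
  set δ₀ : ℝ := min δW (min δV δL) with hδ₀
  have h0 : 0 < δ₀ := lt_min hδW (lt_min hδV hδL)
  have hCW : 0 ≤ CW := (hWf μ y).nonneg (Sum.inl 0)
  have hCV : 0 ≤ CV := (hVf μ y).nonneg (Sum.inl 0)
  have hCL : 0 ≤ CL := (hLf μ y).nonneg (Sum.inl 0)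
  have hW := biLoc_mono (hWf μ y) hCW (min_le_left _ _ : δ₀ ≤ δW)
  have hV := biLoc_mono (hVf μ y) hCV ((min_le_right _ _).trans (min_le_left _ _) : δ₀ ≤ δV)
  have hL := biLoc_mono (hLf μ y) hCL ((min_le_right _ _).trans (min_le_right _ _) : δ₀ ≤ δL)
  have hdW := decays_smul' (decays_dper M hW hCW h0) (P.cE (j + 1))
  have hdV := decays_smul' (decays_dper M hV hCV h0) (P.cVH (j + 1))
  have hdL := decays_smul' (decays_dper M hL hCL h0) (P.cΛ (j + 1))
  rw [VN_apply_eq_sectors R P j μ y, dper_add_smul₃ M hW h0 hV h0 hL h0,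
    perF_add M (decays_add' (decays_smul' (decays_dper M hW hCW h0) _) hdV) hdL (half_pos h0) (half_pos h0),
    perF_add M hdW hdV (half_pos h0) (half_pos h0), perF_smul, perF_smul, perF_smul]

omit [∀ μ, NeZero (M μ)] in
/-- [folklore] **the periodised border sector has no field–field entries** (PART 10 `vertexOfK_compV_inl_inl` under the two period sums). -/
theorem perF_dper_VbN_inl_inl (μ : Fin (3 + 1)) (y : Site (3 + 1)) (p q : ↥(pbox M)) (α β : Fin (3 + 1)) :
    perF M (dper M (vertexOfK (AN R j) (Lc ^ (j + 1)) (compV R.r Lc (j + 1)) μ y)) (p, Sum.inl α) (q, Sum.inl β) = 0 := by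
  simp only [perF_apply, perZ_apply, dper_apply, vertexOfK_compV_inl_inl, tsum_zero]

/-- [folklore] **`perF_dper_VN_inl_inl` — THE FIELD–FIELD ENTRIES OF THE PERIODISED N-VERTEX: WILSON + Λ.** -/
theorem perF_dper_VN_inl_inl (μ : Fin (3 + 1)) (y : Site (3 + 1)) (p q : ↥(pbox M)) (α β : Fin (3 + 1)) :
    perF M (dper M (VN R P j μ y)) (p, Sum.inl α) (q, Sum.inl β) =
      P.cE (j + 1) * perF M (dper M (vertexOfK (AN R j) (Lc ^ (j + 1)) (wilsonA 3) μ y)) (p, Sum.inl α) (q, Sum.inl β) +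
        P.cΛ (j + 1) * perF M (dper M (vertexOfK (AN R j) (Lc ^ (j + 1))
          (SLam (Lc ^ (j + 1)) (lamCoeffOf (KInv (N := Lc ^ (j + 1)) (d := 3)) (Lc ^ (j + 1))) (compH R.r Lc (j + 1))) μ y))
          (p, Sum.inl α) (q, Sum.inl β) := by
  rw [perF_dper_VN_eq R P j M μ y]
  simp only [Matrix.add_apply, Matrix.smul_apply, smul_eq_mul, perF_dper_VbN_inl_inl, mul_zero, add_zero]

/-- [folklore] **`perF_dper_VN_submatrix_ff` — THE `ff` BLOCK THAT `hHN₁` READS**: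
`(perF M (dper M (VN R P j μ y)))|ff = cE (j+1) • (perF M (dper M (𝒲N μ y)))|ff + cΛ (j+1) • (perF M (dper M (ℒN μ y)))|ff`. -/
theorem perF_dper_VN_submatrix_ff (μ : Fin (3 + 1)) (y : Site (3 + 1)) :
    (perF M (dper M (VN R P j μ y))).submatrix (fun b : ↥(pbox M) × Fin (3 + 1) => ((b.1, Sum.inl b.2) : Idx M (Fib 3)))
        (fun b : ↥(pbox M) × Fin (3 + 1) => ((b.1, Sum.inl b.2) : Idx M (Fib 3))) =
      P.cE (j + 1) • (perF M (dper M (vertexOfK (AN R j) (Lc ^ (j + 1)) (wilsonA 3) μ y))).submatrix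
          (fun b : ↥(pbox M) × Fin (3 + 1) => ((b.1, Sum.inl b.2) : Idx M (Fib 3))) (fun b : ↥(pbox M) × Fin (3 + 1) => ((b.1, Sum.inl b.2) : Idx M (Fib 3))) +
        P.cΛ (j + 1) • (perF M (dper M (vertexOfK (AN R j) (Lc ^ (j + 1))
          (SLam (Lc ^ (j + 1)) (lamCoeffOf (KInv (N := Lc ^ (j + 1)) (d := 3)) (Lc ^ (j + 1))) (compH R.r Lc (j + 1))) μ y))).submatrix
          (fun b : ↥(pbox M) × Fin (3 + 1) => ((b.1, Sum.inl b.2) : Idx M (Fib 3))) (fun b : ↥(pbox M) × Fin (3 + 1) => ((b.1, Sum.inl b.2) : Idx M (Fib 3))) := by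
  ext b b'
  simp only [Matrix.submatrix_apply, Matrix.add_apply, Matrix.smul_apply, smul_eq_mul, perF_dper_VN_inl_inl]

/-- [folklore] **`perF_dper_VN_submatrix_ff_eq_sum` — THE SAME BLOCK IN THE SHAPE OF `hH₁f`'s W TERM**: for a box `M` with `Lc^(j+1) ∣ M i`,
`(perF M (dper M (VN R P j μ y)))|ff = cE (j+1) • Σ_b colN b • (perF M (dper M (wilsonA 3 b.2 b.1)))|ff + cΛ (j+1) • Σ_b colN b • (perF M (dper M (S^Λ b.2 b.1)))|ff`,
`colN b = (perF M (AN R j)) ((b.1, inl b.2), (wrapPt M (Lc^(j+1)•y), inr μ))` — the torus `ℋ`-column of the N-chart at the coarse bond. -/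
theorem perF_dper_VN_submatrix_ff_eq_sum (hM : ∀ i, Lc ^ (j + 1) ∣ M i) (μ : Fin (3 + 1)) (y : Site (3 + 1)) :
    (perF M (dper M (VN R P j μ y))).submatrix (fun b : ↥(pbox M) × Fin (3 + 1) => ((b.1, Sum.inl b.2) : Idx M (Fib 3)))
        (fun b : ↥(pbox M) × Fin (3 + 1) => ((b.1, Sum.inl b.2) : Idx M (Fib 3))) =
      P.cE (j + 1) • ∑ b : ↥(pbox M) × Fin (3 + 1),
          perF M (AN R j) (b.1, Sum.inl b.2) (wrapPt M (((Lc ^ (j + 1) : ℕ) : ℤ) • y), Sum.inr μ) •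
            (perF M (dper M (wilsonA 3 b.2 (b.1 : Site (3 + 1))))).submatrix
              (fun b : ↥(pbox M) × Fin (3 + 1) => ((b.1, Sum.inl b.2) : Idx M (Fib 3))) (fun b : ↥(pbox M) × Fin (3 + 1) => ((b.1, Sum.inl b.2) : Idx M (Fib 3))) +
        P.cΛ (j + 1) • ∑ b : ↥(pbox M) × Fin (3 + 1),
          perF M (AN R j) (b.1, Sum.inl b.2) (wrapPt M (((Lc ^ (j + 1) : ℕ) : ℤ) • y), Sum.inr μ) •
            (perF M (dper M (SLam (Lc ^ (j + 1)) (lamCoeffOf (KInv (N := Lc ^ (j + 1)) (d := 3)) (Lc ^ (j + 1))) (compH R.r Lc (j + 1)) b.2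
              (b.1 : Site (3 + 1))))).submatrix
              (fun b : ↥(pbox M) × Fin (3 + 1) => ((b.1, Sum.inl b.2) : Idx M (Fib 3))) (fun b : ↥(pbox M) × Fin (3 + 1) => ((b.1, Sum.inl b.2) : Idx M (Fib 3))) := by
  rw [perF_dper_VN_submatrix_ff R P j M μ y, perF_dper_WN_eq_sum R j M hM μ y, perF_dper_LN_eq_sum R j M hM μ y, submatrix_sum_smul,
    submatrix_sum_smul]

end Sectors

/-! ## §4 At the wrapper's finest torus `towerTorus Lc (fine Lc M) (n+1)` -/

section Tower

omit [NeZero Lc] [∀ μ, NeZero (M μ)] in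
/-- [folklore] the moduli of the finest torus of the `(n+2)`-level tower are multiples of the N-blocking `Lc^(n+2)` (`towerTorus_apply`). -/
theorem dvd_towerTorus_fine (n : ℕ) (i : Fin (3 + 1)) : Lc ^ (n + 2) ∣ towerTorus Lc (fine Lc M) (n + 1) i := by
  rw [← towerTorus_succ, towerTorus_apply]
  exact Dvd.intro _ rfl

/-- [folklore] **`perF_dper_VN_submatrix_ff_tower` — THE `ff` BLOCK OF `hHN₁`'s RIGHT SIDE AT THE WRAPPER's OBJECTS** (`j := n+1`, the finest torus
`T := towerTorus Lc (fine Lc M) (n+1)`; at the wrapper `M := Mc B`, `R := Roots.ctr Lc`, `P := Pn`), both sectors as torus-column-weighted sums, NO side condition: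
`(perF T (dper T (VN R P (n+1) μ y)))|ff = cE (n+2) • Σ_b colN b • (perF T (dper T (wilsonA 3 b.2 b.1)))|ff + cΛ (n+2) • Σ_b colN b • (perF T (dper T (S^Λ b.2 b.1)))|ff`. -/
theorem perF_dper_VN_submatrix_ff_tower (n : ℕ) (μ : Fin (3 + 1)) (y : Site (3 + 1)) :
    (perF (towerTorus Lc (fine Lc M) (n + 1)) (dper (towerTorus Lc (fine Lc M) (n + 1)) (VN R P (n + 1) μ y))).submatrix
        (fun b : ↥(pbox (towerTorus Lc (fine Lc M) (n + 1))) × Fin (3 + 1) => ((b.1, Sum.inl b.2) : Idx (towerTorus Lc (fine Lc M) (n + 1)) (Fib 3)))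
        (fun b : ↥(pbox (towerTorus Lc (fine Lc M) (n + 1))) × Fin (3 + 1) => ((b.1, Sum.inl b.2) : Idx (towerTorus Lc (fine Lc M) (n + 1)) (Fib 3))) =
      P.cE (n + 1 + 1) • ∑ b : ↥(pbox (towerTorus Lc (fine Lc M) (n + 1))) × Fin (3 + 1),
          perF (towerTorus Lc (fine Lc M) (n + 1)) (AN R (n + 1)) (b.1, Sum.inl b.2)
              (wrapPt (towerTorus Lc (fine Lc M) (n + 1)) (((Lc ^ (n + 1 + 1) : ℕ) : ℤ) • y), Sum.inr μ) •
            (perF (towerTorus Lc (fine Lc M) (n + 1)) (dper (towerTorus Lc (fine Lc M) (n + 1)) (wilsonA 3 b.2 (b.1 : Site (3 + 1))))).submatrix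
              (fun b : ↥(pbox (towerTorus Lc (fine Lc M) (n + 1))) × Fin (3 + 1) => ((b.1, Sum.inl b.2) : Idx (towerTorus Lc (fine Lc M) (n + 1)) (Fib 3)))
              (fun b : ↥(pbox (towerTorus Lc (fine Lc M) (n + 1))) × Fin (3 + 1) => ((b.1, Sum.inl b.2) : Idx (towerTorus Lc (fine Lc M) (n + 1)) (Fib 3))) +
        P.cΛ (n + 1 + 1) • ∑ b : ↥(pbox (towerTorus Lc (fine Lc M) (n + 1))) × Fin (3 + 1),
          perF (towerTorus Lc (fine Lc M) (n + 1)) (AN R (n + 1)) (b.1, Sum.inl b.2)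
              (wrapPt (towerTorus Lc (fine Lc M) (n + 1)) (((Lc ^ (n + 1 + 1) : ℕ) : ℤ) • y), Sum.inr μ) •
            (perF (towerTorus Lc (fine Lc M) (n + 1)) (dper (towerTorus Lc (fine Lc M) (n + 1))
              (SLam (Lc ^ (n + 1 + 1)) (lamCoeffOf (KInv (N := Lc ^ (n + 1 + 1)) (d := 3)) (Lc ^ (n + 1 + 1))) (compH R.r Lc (n + 1 + 1)) b.2
                (b.1 : Site (3 + 1))))).submatrix
              (fun b : ↥(pbox (towerTorus Lc (fine Lc M) (n + 1))) × Fin (3 + 1) => ((b.1, Sum.inl b.2) : Idx (towerTorus Lc (fine Lc M) (n + 1)) (Fib 3)))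
              (fun b : ↥(pbox (towerTorus Lc (fine Lc M) (n + 1))) × Fin (3 + 1) => ((b.1, Sum.inl b.2) : Idx (towerTorus Lc (fine Lc M) (n + 1)) (Fib 3))) :=
  perF_dper_VN_submatrix_ff_eq_sum R P (n + 1) (towerTorus Lc (fine Lc M) (n + 1)) (dvd_towerTorus_fine M n) μ y

end Tower

end Summit.QuantumFields.BalabanUV.Beta.NVertexSectorsPeriodised

end
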